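import Literature.Analysis.ValidatedNumerics.TaylorModelIntegralCertFamily
import Literature.Analysis.ValidatedNumerics.TaylorModelIntegralCert2DLogWeighted
import HarnessLib

/-!
# Filon-type product integration against an oscillatory weight, with kernel-checked certificates

Trunk T-ANA (Analysis/ValidatedNumerics); namespace `Literature.Analysis.ValidatedNumerics.PolyMP`.
Sequel of `TaylorModelIntegralCertFamily.lean` (integral certificates generic in the statement family: `OpModel` /
`OpSem`, the panel model `M.pmodelP`, `F.tmem_pmodelP`) and of `TaylorModelIntegralCert2DLogWeighted.lean` (product
integration of a coefficient row against the moments of a weight: `wsumR`, `integral_weight_mul_pow_mul_evalR`, and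
its interval form `wsumI` / `mem_wsumI`).

Davis–Rabinowitz, *Methods of Numerical Integration*, 2nd ed. (1984), Sect. 2.10 (integrals of oscillatory
functions) and Sect. 2.10.2 ("Use of approximation: Filon's method for finite Fourier integrals"): write
`f = Σ aₖ φₖ + ε` with `ε` small and the transforms `∫ φₖ(x) K(t, x) dx` computable in elementary terms (the case
`φₖ(x) = xᵏ`, `K = e^{itx}`); then `∫ f K ≈ Σ aₖ ∫ φₖ K` — Filon approximates `f` by parabolic arcs, "for parabolic
`f(t)` the Fourier integrals can be computed explicitly by integration by parts", and "if `max |f − p₂| ≤ ε`, then a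
uniform bound on the error in Filon's method is given by `(b − a) ε`", however large the frequency.  Iserles, IMA J.
Numer. Anal. 24 (2004), Sect. 3, (3.2): the Filon-type method `Q_h^F[f] = I_h[f̃]` — replace `f` by a polynomial
approximation `f̃` and integrate `f̃ · e^{iωx}` EXACTLY; its error does not deteriorate (indeed improves) as `ω → ∞`.

This module is the kernel-certified version for the certificate lane of this directory.  The integrand is
`P(ps; t) · w(t)` with `P` a straight-line program of ANY statement family (`OpModel` / `OpSem`: `exp`, `log`, `sin`,
`cos`, `atan`, `1/·`, `√·`, polynomials, interval parameters `ps ∈ B`) and the OSCILLATORY WEIGHT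

  `w(t) = a · cos(ω t + φ) + b · sin(ω t + φ)`,   `a, b, ω, φ ∈ ℚ`, `ω ≠ 0`

(`OscW`; `cosW ω φ`, `sinW ω φ` the two pure cases).  On a panel `t = c + u`, `|u| ≤ h`, the program is enclosed
by its Taylor model `W` (as in every certificate of the lane), the weight is EXPANDED EXACTLY,
`w(c + u) = A cos(ω u) + B sin(ω u)` with `A = a cos θ + b sin θ`, `B = b cos θ − a sin θ`, `θ = ω c + φ`
(`OscW.toFun_centre`), and the midpoint polynomial `p_W` of `W` is integrated against it through the trigonometric
MOMENTS `∫_{-h}^{h} cos(ω u) uᵏ du`, `∫_{-h}^{h} sin(ω u) uᵏ du` (`cosMom`, `sinMom`), generated by the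
integration-by-parts recurrence (`cosMom_succ`, `sinMom_succ`, bases `2 sin(ω h)/ω` and `0`).  The remainder is
bounded by `(tabsI S h (W − p_W)/S) · 2h · (|a| + |b|)` (`abs_integral_mul_weight_sub_le`, the displayed
`(b − a) ε` bound with `|w| ≤ |a| + |b|`), uniformly in `ω`: the panel count is governed by the smoothness of `P`
alone, not by the frequency — where the ordinary lane (`sin`/`cos` of a wide argument Taylor-modelled as part of the
integrand, `TaylorModelSinCosWide.lean`) needs panels of width `O(1/ω)`.

* Part A — the moments `cosMom ω h k`, `sinMom ω h k` and their recurrences (integration by parts, Mathlib's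
  `intervalIntegral.integral_mul_deriv_eq_deriv_mul`); the weight `OscW`, its bound `|w| ≤ |a| + |b|` and the
  re-centring identity; the panel estimate `abs_integral_mul_weight_sub_le` for ANY bounded continuous weight.
* Part B — the computable side, in the scaled-integer interval arithmetic `MI` at an internal scale `T` (parameter
  record `OscPrm`: `T`, and the series terms / halvings `Kt`, `kt` of the point values `e^{ix}` by `cisPt`):
  `trigPt` (enclosures of `cos x`, `sin x` at rational `x`), `oscMomI` (the moment recurrence in interval
  arithmetic, `mem_oscMomI`), `oscMuI` (the moments of the re-centred weight), and the panel enclosure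
  `oscPanelI prm S h W w c` of `∫_{-h}^{h} f(c + u) w(c + u) du` from a Taylor model `W` of `u ↦ f(c + u)`
  (`mem_oscPanelI`): rows paired with interval moments by `wsumI` at scale `T`, rescaled to `S`, widened by the
  remainder bound.  Upward instability of the recurrence for `k > ω h` costs bits of `T`, never soundness.
* Part C — segments: `OSegOK f w S a b lo hi` (`lo ≤ S ∫_a^b f w ≤ hi` and integrability), `OSegOK.append`,
  `OSegOK.bounds`, and `osegOK_of_tmem` (a certified segment over `[c − h, c + h]` from a Taylor model and the kernel's
  check of `oscPanelI`).
* Part D — generic over the statement family: the per-panel certificate `M.oscPanelCheck` with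
  `F.osegOK_of_oscPanelCheck`, and the leaf-list certificate `M.oscCertCheck prm oprm S p B w a b L lo hi` (leaves
  `(cⱼ, hⱼ)` of any widths tiling `[a, b]` in order, each with its claimed scaled enclosure, re-checked by the kernel)
  with **`F.integral_bounds_of_oscCertCheck`**:
  `M.oscCertCheck … = true → BoxMem ps B → lo ≤ ∫_a^b F.toFunP p ps t · w.toFun t dt ≤ hi`.
* Part E — certificate generation by `#eval` (untrusted, outside the kernel): `M.oscLeafOf` (the kernel's own panel
  enclosure as the claimed one), `M.oscUniform` (a run of equal panels) and `M.oscAdapt` (dyadic bisection until the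
  panel enclosure is narrower than a tolerance per unit length).

Deliberately NOT here: stationary points of a nonlinear phase `e^{iωg(t)}` (they need the moments of `e^{iωg}`,
i.e. Levin-type methods), Bessel and other oscillators, infinite ranges.  Problem-independent; no facts, no axioms;
all certificate data computable over `ℚ` and `ℤ`.

References: [cite: DavisRabinowitz1984, Sect. 2.10.2]; [cite: DavisRabinowitz1984, Sect. 2.5.6]; [cite: Iserles2004, Sect. 3];
[cite: MahboubiMelquiondSibutpinote2016, Sect. 3.2 Lemma 3, Sect. 3.3]; [cite: MahboubiMelquiondSibutpinote2016, Sect. 4.1];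
[cite: Melquiond2008, Sect. 3.3]; [cite: MakinoBerz2003, Algorithm 2]; [cite: BrentZimmermann2010, §4.3.1].
-/

open MeasureTheory intervalIntegral Set
open scoped Interval

namespace Literature.Analysis.ValidatedNumerics

namespace PolyMP

open Literature.Analysis.ValidatedNumerics.NumericsMP
open Literature.Analysis.ValidatedNumerics.ExpPoly (Poly)
open Literature.Analysis.ValidatedNumerics.ExpPoly

/-! ### Part A. Trigonometric moments over a symmetric panel; the oscillatory weight; the panel estimate -/

/-- The cosine moment `∫_{-h}^{h} cos(ω u) uᵏ du` of the panel `|u| ≤ h` (the transform `ψₖ` of `φₖ(u) = uᵏ`, op. cit.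
(2.10.2.2), real part). [cite: DavisRabinowitz1984, Sect. 2.10.2] -/
noncomputable def cosMom (ω h : ℝ) (k : ℕ) : ℝ := ∫ u in (-h)..h, Real.cos (ω * u) * u ^ k

/-- The sine moment `∫_{-h}^{h} sin(ω u) uᵏ du` of the panel `|u| ≤ h` (op. cit. (2.10.2.2), imaginary part).
[cite: DavisRabinowitz1984, Sect. 2.10.2] -/
noncomputable def sinMom (ω h : ℝ) (k : ℕ) : ℝ := ∫ u in (-h)..h, Real.sin (ω * u) * u ^ k

/-- [folklore] -/
private theorem continuous_cos_mulO (ω : ℝ) : Continuous fun u : ℝ => Real.cos (ω * u) :=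
  Real.continuous_cos.comp (continuous_const.mul continuous_id)

/-- [folklore] -/
private theorem continuous_sin_mulO (ω : ℝ) : Continuous fun u : ℝ => Real.sin (ω * u) :=
  Real.continuous_sin.comp (continuous_const.mul continuous_id)

/-- [folklore] -/
private theorem hasDerivAt_sin_mulO (ω x : ℝ) :
    HasDerivAt (fun y : ℝ => Real.sin (ω * y)) (ω * Real.cos (ω * x)) x := by
  have h1 : HasDerivAt (fun y : ℝ => ω * y) ω x := by
    simpa using (hasDerivAt_id x).const_mul ω
  have h2 := (Real.hasDerivAt_sin (ω * x)).comp x h1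
  have e : Real.cos (ω * x) * ω = ω * Real.cos (ω * x) := mul_comm _ _
  rw [e] at h2
  exact h2

/-- [folklore] -/
private theorem hasDerivAt_cos_mulO (ω x : ℝ) :
    HasDerivAt (fun y : ℝ => Real.cos (ω * y)) (-(ω * Real.sin (ω * x))) x := by
  have h1 : HasDerivAt (fun y : ℝ => ω * y) ω x := by
    simpa using (hasDerivAt_id x).const_mul ω
  have h2 := (Real.hasDerivAt_cos (ω * x)).comp x h1
  have e : -Real.sin (ω * x) * ω = -(ω * Real.sin (ω * x)) := by ring
  rw [e] at h2
  exact h2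

/-- [folklore] -/
private theorem hasDerivAt_sin_mul_divO {ω : ℝ} (hω : ω ≠ 0) (x : ℝ) :
    HasDerivAt (fun y : ℝ => Real.sin (ω * y) / ω) (Real.cos (ω * x)) x := by
  have h := (hasDerivAt_sin_mulO ω x).div_const ω
  have e : ω * Real.cos (ω * x) / ω = Real.cos (ω * x) := mul_div_cancel_left₀ _ hω
  rw [e] at h
  exact h

/-- [folklore] -/
private theorem hasDerivAt_neg_cos_mul_divO {ω : ℝ} (hω : ω ≠ 0) (x : ℝ) :
    HasDerivAt (fun y : ℝ => -Real.cos (ω * y) / ω) (Real.sin (ω * x)) x := by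
  have h := ((hasDerivAt_cos_mulO ω x).neg).div_const ω
  have e : -(-(ω * Real.sin (ω * x))) / ω = Real.sin (ω * x) := by
    rw [neg_neg]; exact mul_div_cancel_left₀ _ hω
  rw [e] at h
  exact h

/-- **Base of the cosine moments**: `∫_{-h}^{h} cos(ω u) du = 2 sin(ω h)/ω` (`ω ≠ 0`).
[cite: DavisRabinowitz1984, Sect. 2.10.2] -/
theorem cosMom_zero {ω : ℝ} (hω : ω ≠ 0) (h : ℝ) : cosMom ω h 0 = 2 * Real.sin (ω * h) / ω := by
  unfold cosMom
  simp only [pow_zero, mul_one]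
  rw [integral_eq_sub_of_hasDerivAt (fun x _ => hasDerivAt_sin_mul_divO hω x)
    ((continuous_cos_mulO ω).intervalIntegrable _ _)]
  rw [mul_neg, Real.sin_neg]
  ring

/-- **Base of the sine moments**: `∫_{-h}^{h} sin(ω u) du = 0`. [cite: DavisRabinowitz1984, Sect. 2.10.2] -/
theorem sinMom_zero {ω : ℝ} (hω : ω ≠ 0) (h : ℝ) : sinMom ω h 0 = 0 := by
  unfold sinMom
  simp only [pow_zero, mul_one]
  rw [integral_eq_sub_of_hasDerivAt (fun x _ => hasDerivAt_neg_cos_mul_divO hω x)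
    ((continuous_sin_mulO ω).intervalIntegrable _ _)]
  rw [mul_neg, Real.cos_neg]
  ring

/-- **The cosine moment recurrence** (integration by parts, `u^{k+1}` against `d(sin(ω u)/ω)`):
`∫ cos(ω u) u^{k+1} = ((h^{k+1} + (−h)^{k+1}) sin(ω h) − (k+1) ∫ sin(ω u) uᵏ)/ω`.
[cite: DavisRabinowitz1984, Sect. 2.10.2] -/
theorem cosMom_succ {ω : ℝ} (hω : ω ≠ 0) (h : ℝ) (k : ℕ) :
    cosMom ω h (k + 1) =
      ((h ^ (k + 1) + (-h) ^ (k + 1)) * Real.sin (ω * h) - (k + 1) * sinMom ω h k) / ω := by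
  unfold cosMom sinMom
  have hu : ∀ x ∈ uIcc (-h) h, HasDerivAt (fun y : ℝ => y ^ (k + 1)) (((k + 1 : ℕ) : ℝ) * x ^ k) x := by
    intro x _
    simpa using hasDerivAt_pow (k + 1) x
  have ibp := integral_mul_deriv_eq_deriv_mul hu (fun x _ => hasDerivAt_sin_mul_divO hω x)
    ((continuous_const.mul (continuous_pow k)).intervalIntegrable _ _)
    ((continuous_cos_mulO ω).intervalIntegrable _ _)
  have e1 : ∫ u in (-h)..h, Real.cos (ω * u) * u ^ (k + 1) = ∫ u in (-h)..h, u ^ (k + 1) * Real.cos (ω * u) :=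
    integral_congr fun u _ => mul_comm _ _
  have e2 : ∫ x in (-h)..h, ((k + 1 : ℕ) : ℝ) * x ^ k * (Real.sin (ω * x) / ω) =
      ((k + 1 : ℕ) : ℝ) / ω * ∫ x in (-h)..h, Real.sin (ω * x) * x ^ k := by
    rw [← intervalIntegral.integral_const_mul]
    exact integral_congr fun x _ => by ring
  rw [e1, ibp, e2, mul_neg, Real.sin_neg]
  push_cast
  field_simp
  ring

/-- **The sine moment recurrence** (integration by parts, `u^{k+1}` against `d(−cos(ω u)/ω)`):
`∫ sin(ω u) u^{k+1} = ((k+1) ∫ cos(ω u) uᵏ − (h^{k+1} − (−h)^{k+1}) cos(ω h))/ω`.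
[cite: DavisRabinowitz1984, Sect. 2.10.2] -/
theorem sinMom_succ {ω : ℝ} (hω : ω ≠ 0) (h : ℝ) (k : ℕ) :
    sinMom ω h (k + 1) =
      ((k + 1) * cosMom ω h k - (h ^ (k + 1) - (-h) ^ (k + 1)) * Real.cos (ω * h)) / ω := by
  unfold cosMom sinMom
  have hu : ∀ x ∈ uIcc (-h) h, HasDerivAt (fun y : ℝ => y ^ (k + 1)) (((k + 1 : ℕ) : ℝ) * x ^ k) x := by
    intro x _
    simpa using hasDerivAt_pow (k + 1) x
  have ibp := integral_mul_deriv_eq_deriv_mul hu (fun x _ => hasDerivAt_neg_cos_mul_divO hω x)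
    ((continuous_const.mul (continuous_pow k)).intervalIntegrable _ _)
    ((continuous_sin_mulO ω).intervalIntegrable _ _)
  have e1 : ∫ u in (-h)..h, Real.sin (ω * u) * u ^ (k + 1) = ∫ u in (-h)..h, u ^ (k + 1) * Real.sin (ω * u) :=
    integral_congr fun u _ => mul_comm _ _
  have e2 : ∫ x in (-h)..h, ((k + 1 : ℕ) : ℝ) * x ^ k * (-Real.cos (ω * x) / ω) =
      -(((k + 1 : ℕ) : ℝ) / ω) * ∫ x in (-h)..h, Real.cos (ω * x) * x ^ k := by
    rw [← intervalIntegral.integral_const_mul]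
    exact integral_congr fun x _ => by ring
  rw [e1, ibp, e2, mul_neg, Real.cos_neg]
  push_cast
  field_simp
  ring

/-- **The oscillatory weight** `w(t) = a cos(ω t + φ) + b sin(ω t + φ)` with rational data (the kernel
`K(t, x)` of the finite Fourier integral, both real components at once). [cite: DavisRabinowitz1984, Sect. 2.10.2] -/
structure OscW : Type where
  /-- cosine amplitude -/
  a : ℚ
  /-- sine amplitude -/
  b : ℚ
  /-- frequency (`≠ 0` in every certificate) -/
  ω : ℚ
  /-- phase -/
  φ : ℚ
  deriving Inhabited, Repr, DecidableEq

namespace OscW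

/-- The weight as a real function. [cite: DavisRabinowitz1984, Sect. 2.10.2] -/
noncomputable def toFun (w : OscW) (t : ℝ) : ℝ :=
  (w.a : ℝ) * Real.cos ((w.ω : ℝ) * t + w.φ) + (w.b : ℝ) * Real.sin ((w.ω : ℝ) * t + w.φ)

/-- The pure cosine weight `cos(ω t + φ)`. [cite: DavisRabinowitz1984, Sect. 2.10.2] -/
def cosW (ω φ : ℚ) : OscW := ⟨1, 0, ω, φ⟩

/-- The pure sine weight `sin(ω t + φ)`. [cite: DavisRabinowitz1984, Sect. 2.10.2] -/
def sinW (ω φ : ℚ) : OscW := ⟨0, 1, ω, φ⟩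

/-- [cite: DavisRabinowitz1984, Sect. 2.10.2] -/
@[simp] theorem toFun_cosW (ω φ : ℚ) (t : ℝ) : (cosW ω φ).toFun t = Real.cos ((ω : ℝ) * t + φ) := by
  simp [toFun, cosW]

/-- [cite: DavisRabinowitz1984, Sect. 2.10.2] -/
@[simp] theorem toFun_sinW (ω φ : ℚ) (t : ℝ) : (sinW ω φ).toFun t = Real.sin ((ω : ℝ) * t + φ) := by
  simp [toFun, sinW]

/-- The weight is continuous. [cite: DavisRabinowitz1984, Sect. 2.10.2] -/
theorem continuous_toFun (w : OscW) : Continuous w.toFun := by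
  unfold toFun
  fun_prop

/-- `|w(t)| ≤ |a| + |b|`. [cite: DavisRabinowitz1984, Sect. 2.10.2] -/
theorem abs_toFun_le (w : OscW) (t : ℝ) : |w.toFun t| ≤ (((|w.a| + |w.b| : ℚ)) : ℝ) := by
  unfold toFun
  have h1 : |(w.a : ℝ) * Real.cos ((w.ω : ℝ) * t + w.φ)| ≤ |(w.a : ℝ)| := by
    rw [abs_mul]
    exact mul_le_of_le_one_right (abs_nonneg _) (Real.abs_cos_le_one _)
  have h2 : |(w.b : ℝ) * Real.sin ((w.ω : ℝ) * t + w.φ)| ≤ |(w.b : ℝ)| := by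
    rw [abs_mul]
    exact mul_le_of_le_one_right (abs_nonneg _) (Real.abs_sin_le_one _)
  push_cast
  exact (abs_add_le _ _).trans (add_le_add h1 h2)

/-- **Re-centring the weight on a panel**: `w(c + u) = (a cos θ + b sin θ) cos(ω u) + (b cos θ − a sin θ) sin(ω u)`
with `θ = ω c + φ` — so that on every panel only the moments of `cos(ω u)`, `sin(ω u)` are needed.
[cite: DavisRabinowitz1984, Sect. 2.10.2] -/
theorem toFun_centre (w : OscW) (c u : ℝ) :
    w.toFun (c + u) =
      ((w.a : ℝ) * Real.cos ((w.ω : ℝ) * c + w.φ) + (w.b : ℝ) * Real.sin ((w.ω : ℝ) * c + w.φ)) * Real.cos ((w.ω : ℝ) * u) +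
        ((w.b : ℝ) * Real.cos ((w.ω : ℝ) * c + w.φ) - (w.a : ℝ) * Real.sin ((w.ω : ℝ) * c + w.φ)) *
          Real.sin ((w.ω : ℝ) * u) := by
  unfold toFun
  have e : (w.ω : ℝ) * (c + u) + w.φ = (w.ω : ℝ) * u + ((w.ω : ℝ) * c + w.φ) := by ring
  rw [e, Real.cos_add ((w.ω : ℝ) * u) ((w.ω : ℝ) * c + w.φ), Real.sin_add ((w.ω : ℝ) * u) ((w.ω : ℝ) * c + w.φ)]
  ring

/-- **The moments of the re-centred weight**: `∫_{-h}^{h} w(c + u) uⁱ du = A · cosMom ω h i + B · sinMom ω h i`.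
[cite: DavisRabinowitz1984, Sect. 2.10.2] -/
theorem integral_toFun_centre_mul_pow (w : OscW) (c h : ℝ) (i : ℕ) :
    ∫ u in (-h)..h, w.toFun (c + u) * u ^ i =
      ((w.a : ℝ) * Real.cos ((w.ω : ℝ) * c + w.φ) + (w.b : ℝ) * Real.sin ((w.ω : ℝ) * c + w.φ)) * cosMom w.ω h i +
        ((w.b : ℝ) * Real.cos ((w.ω : ℝ) * c + w.φ) - (w.a : ℝ) * Real.sin ((w.ω : ℝ) * c + w.φ)) * sinMom w.ω h i := by
  unfold cosMom sinMom
  set A : ℝ := (w.a : ℝ) * Real.cos ((w.ω : ℝ) * c + w.φ) + (w.b : ℝ) * Real.sin ((w.ω : ℝ) * c + w.φ) with hA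
  set B : ℝ := (w.b : ℝ) * Real.cos ((w.ω : ℝ) * c + w.φ) - (w.a : ℝ) * Real.sin ((w.ω : ℝ) * c + w.φ) with hB
  have hpt : ∀ u : ℝ, w.toFun (c + u) * u ^ i =
      A * (Real.cos ((w.ω : ℝ) * u) * u ^ i) + B * (Real.sin ((w.ω : ℝ) * u) * u ^ i) := by
    intro u; rw [toFun_centre]; ring
  simp_rw [hpt]
  have i1 : IntervalIntegrable (fun u => A * (Real.cos ((w.ω : ℝ) * u) * u ^ i)) volume (-h) h :=
    (continuous_const.mul ((continuous_cos_mulO _).mul (continuous_pow i))).intervalIntegrable _ _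
  have i2 : IntervalIntegrable (fun u => B * (Real.sin ((w.ω : ℝ) * u) * u ^ i)) volume (-h) h :=
    (continuous_const.mul ((continuous_sin_mulO _).mul (continuous_pow i))).intervalIntegrable _ _
  rw [integral_add i1 i2, intervalIntegral.integral_const_mul, intervalIntegral.integral_const_mul]

end OscW

/-- **Panel quadrature against a Taylor model and a bounded weight** (the `(b − a) ε` remainder bound of Filon's
method, with `|w| ≤ L`): if `P` encloses `f` on `|u| ≤ h`, `f` is interval integrable there, `w` is continuous with
`|w| ≤ L`, then for every rational polynomial `p`,
`|∫_{-h}^{h} f w − ∫_{-h}^{h} p w| ≤ (tabsI S h (P − p)/S) · (2h · L)`. [cite: DavisRabinowitz1984, Sect. 2.10.2] -/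
theorem abs_integral_mul_weight_sub_le {S : ℕ} (hS : 0 < S) {h : ℚ} (h0 : 0 ≤ h) {f : ℝ → ℝ} {P : IPoly}
    (hf : TMem S h f P) (hfi : IntervalIntegrable f volume (-(h : ℝ)) h) {w : ℝ → ℝ} (hw : Continuous w) {L : ℚ}
    (hL : ∀ u : ℝ, |w u| ≤ L) (p : Poly) :
    |(∫ u in (-(h : ℝ))..h, f u * w u) - ∫ u in (-(h : ℝ))..h, Poly.eval p u * w u| ≤
      (tabsI S h (tsubI P (ratPolyI S p)) : ℝ) / S * (2 * h * L) := by
  set B : ℤ := tabsI S h (tsubI P (ratPolyI S p)) with hB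
  have hSr : (0 : ℝ) < S := by exact_mod_cast hS
  have hp_cont : Continuous fun u => Poly.eval p u := Poly.continuous_eval p
  have hfw : IntervalIntegrable (fun u => f u * w u) volume (-(h : ℝ)) h := hfi.mul_continuousOn hw.continuousOn
  have hpw : IntervalIntegrable (fun u => Poly.eval p u * w u) volume (-(h : ℝ)) h :=
    (hp_cont.mul hw).intervalIntegrable _ _
  rw [← integral_sub hfw hpw]
  have hdiff := tmem_sub hf (tmem_ratPoly S h p)
  have hpt : ∀ x ∈ Ι (-(h : ℝ)) h, ‖f x * w x - Poly.eval p x * w x‖ ≤ (B : ℝ) / S * L := by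
    intro x hx
    have hh : (-(h : ℝ)) ≤ h := by linarith [(by exact_mod_cast h0 : (0 : ℝ) ≤ h)]
    rw [uIoc_of_le hh] at hx
    have hxa : |x| ≤ h := abs_le.2 ⟨hx.1.le, hx.2⟩
    have h1 : |f x - Poly.eval p x| * S ≤ (B : ℝ) := abs_le_tabsI h0 hdiff hxa
    have h2 : |w x| ≤ (L : ℝ) := hL x
    rw [Real.norm_eq_abs, ← sub_mul, abs_mul]
    have h1' : |f x - Poly.eval p x| ≤ (B : ℝ) / S := by rw [le_div_iff₀ hSr]; exact h1
    exact mul_le_mul h1' h2 (abs_nonneg _) ((abs_nonneg _).trans h1')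
  refine (norm_integral_le_of_norm_le_const hpt).trans (le_of_eq ?_)
  have : |(h : ℝ) - -(h : ℝ)| = 2 * h := by
    rw [sub_neg_eq_add, abs_of_nonneg (by positivity)]; ring
  rw [this]
  ring

/-! ### Part B. Interval moments and the panel enclosure -/

/-- Parameters of the moment arithmetic: the internal scale `T` of the interval recurrence (typically `S · 2⁶⁴` or
more: the upward recurrence loses `≈ log₂(k!/|ω h|ᵏ)` bits at order `k` when `|ω| h < k`), and the series terms `Kt`
and halvings `kt` of the point values `e^{ix}` (`cisPt`). [cite: BrentZimmermann2010, §4.3.1] -/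
structure OscPrm : Type where
  /-- internal scale of the moment arithmetic -/
  T : ℕ
  /-- series terms of the point values `e^{ix}` -/
  Kt : ℕ
  /-- halvings / squarings of the point values `e^{ix}` -/
  kt : ℕ
  deriving Inhabited, Repr

/-- Enclosures of `cos x` and `sin x` at a rational point, at scale `prm.T` (real and imaginary parts of
`cisPt`), with the acceptance flag. [cite: BrentZimmermann2010, §4.3.1] -/
def trigPt (prm : OscPrm) (x : ℚ) : MC × Bool :=
  match cisPt prm.T prm.Kt prm.kt (ofRat prm.T x) with
  | some Y => (Y, true)
  | none => (⟨zeroMI, zeroMI⟩, false)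

/-- [cite: BrentZimmermann2010, §4.3.1] -/
theorem mem_trigPt {prm : OscPrm} (hT : 0 < prm.T) {x : ℚ} (hok : (trigPt prm x).2 = true) :
    MI.mem prm.T (Real.cos x) (trigPt prm x).1.re ∧ MI.mem prm.T (Real.sin x) (trigPt prm x).1.im := by
  rcases hY : cisPt prm.T prm.Kt prm.kt (ofRat prm.T x) with _ | Y
  · have e : (trigPt prm x).2 = false := by simp [trigPt, hY]
    rw [e] at hok
    exact absurd hok (by decide)
  · have e : trigPt prm x = (Y, true) := by simp [trigPt, hY]
    rw [e]
    exact ⟨mem_cos_of_cisPt hT hY (mem_ofRat prm.T x), mem_sin_of_cisPt hT hY (mem_ofRat prm.T x)⟩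

/-- [folklore] -/
private theorem mem_zeroMI_O (T : ℕ) : MI.mem T 0 zeroMI := by
  simp [MI.mem, zeroMI]

/-- Natural powers of a rational by repeated multiplication (kernel-friendly). [folklore] -/
private def qpow (q : ℚ) : ℕ → ℚ
  | 0 => 1
  | n + 1 => qpow q n * q

/-- [folklore] -/
private theorem qpow_eq_pow (q : ℚ) : ∀ n : ℕ, qpow q n = q ^ n
  | 0 => by simp [qpow]
  | n + 1 => by rw [qpow, qpow_eq_pow q n, pow_succ]

/-- One step of the moment recurrence in interval arithmetic: from `(C_k, S_k) ∋ (cosMom k, sinMom k)` to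
`(C_{k+1}, S_{k+1})`, given `cI ∋ cos(ω h)`, `sI ∋ sin(ω h)` (exact rational coefficients `h^{k+1} ± (−h)^{k+1}`,
`k + 1`, `1/ω`). [cite: DavisRabinowitz1984, Sect. 2.10.2] -/
def oscMomStep (ω h : ℚ) (cI sI : MI) (k : ℕ) (p : MI × MI) : MI × MI :=
  (mulRatI ((mulRatI sI (qpow h (k + 1) + qpow (-h) (k + 1))).sub (p.2.mulInt ((k : ℤ) + 1))) (1 / ω),
   mulRatI ((p.1.mulInt ((k : ℤ) + 1)).sub (mulRatI cI (qpow h (k + 1) - qpow (-h) (k + 1)))) (1 / ω))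

/-- **The trigonometric moments in interval arithmetic**: `(oscMomI ω h cI sI k).1 ∋ cosMom ω h k`,
`(…).2 ∋ sinMom ω h k` (bases `2 sin(ω h)/ω`, `0`; then `oscMomStep`). [cite: DavisRabinowitz1984, Sect. 2.10.2] -/
def oscMomI (ω h : ℚ) (cI sI : MI) : ℕ → MI × MI
  | 0 => (mulRatI sI (2 / ω), zeroMI)
  | k + 1 => oscMomStep ω h cI sI k (oscMomI ω h cI sI k)

/-- [cite: DavisRabinowitz1984, Sect. 2.10.2] -/
theorem mem_oscMomStep {T : ℕ} {ω h : ℚ} (hω : ω ≠ 0) {cI sI : MI}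
    (hc : MI.mem T (Real.cos ((ω : ℝ) * h)) cI) (hs : MI.mem T (Real.sin ((ω : ℝ) * h)) sI) (k : ℕ) {p : MI × MI}
    (h1 : MI.mem T (cosMom ω h k) p.1) (h2 : MI.mem T (sinMom ω h k) p.2) :
    MI.mem T (cosMom ω h (k + 1)) (oscMomStep ω h cI sI k p).1 ∧
      MI.mem T (sinMom ω h (k + 1)) (oscMomStep ω h cI sI k p).2 := by
  have hωR : (ω : ℝ) ≠ 0 := by exact_mod_cast hω
  refine ⟨?_, ?_⟩
  · have m := mem_mulRatI (MI.mem_sub (mem_mulRatI hs (qpow h (k + 1) + qpow (-h) (k + 1)))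
      (MI.mem_mulInt h2 ((k : ℤ) + 1))) (1 / ω)
    have e : (Real.sin ((ω : ℝ) * h) * ((qpow h (k + 1) + qpow (-h) (k + 1) : ℚ) : ℝ) -
        sinMom ω h k * (((k : ℤ) + 1 : ℤ) : ℝ)) * ((1 / ω : ℚ) : ℝ) =
        (((h : ℝ) ^ (k + 1) + (-(h : ℝ)) ^ (k + 1)) * Real.sin ((ω : ℝ) * h) - (k + 1) * sinMom ω h k) / ω := by
      rw [qpow_eq_pow, qpow_eq_pow]
      push_cast
      field_simp
    rw [oscMomStep, cosMom_succ hωR, ← e]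
    exact m
  · have m := mem_mulRatI (MI.mem_sub (MI.mem_mulInt h1 ((k : ℤ) + 1))
      (mem_mulRatI hc (qpow h (k + 1) - qpow (-h) (k + 1)))) (1 / ω)
    have e : (cosMom ω h k * (((k : ℤ) + 1 : ℤ) : ℝ) -
        Real.cos ((ω : ℝ) * h) * ((qpow h (k + 1) - qpow (-h) (k + 1) : ℚ) : ℝ)) * ((1 / ω : ℚ) : ℝ) =
        ((k + 1) * cosMom ω h k - ((h : ℝ) ^ (k + 1) - (-(h : ℝ)) ^ (k + 1)) * Real.cos ((ω : ℝ) * h)) / ω := by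
      rw [qpow_eq_pow, qpow_eq_pow]
      push_cast
      field_simp
    rw [oscMomStep, sinMom_succ hωR, ← e]
    exact m

/-- **Soundness of the interval moments.** [cite: DavisRabinowitz1984, Sect. 2.10.2] -/
theorem mem_oscMomI {T : ℕ} {ω h : ℚ} (hω : ω ≠ 0) {cI sI : MI}
    (hc : MI.mem T (Real.cos ((ω : ℝ) * h)) cI) (hs : MI.mem T (Real.sin ((ω : ℝ) * h)) sI) :
    ∀ k : ℕ, MI.mem T (cosMom ω h k) (oscMomI ω h cI sI k).1 ∧ MI.mem T (sinMom ω h k) (oscMomI ω h cI sI k).2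
  | 0 => by
      have hωR : (ω : ℝ) ≠ 0 := by exact_mod_cast hω
      refine ⟨?_, ?_⟩
      · have m := mem_mulRatI hs (2 / ω)
        have e : Real.sin ((ω : ℝ) * h) * ((2 / ω : ℚ) : ℝ) = 2 * Real.sin ((ω : ℝ) * h) / ω := by
          push_cast; ring
        rw [oscMomI, cosMom_zero hωR, ← e]
        exact m
      · rw [oscMomI, sinMom_zero hωR]
        exact mem_zeroMI_O T
  | k + 1 => by
      obtain ⟨ih1, ih2⟩ := mem_oscMomI hω hc hs k
      rw [oscMomI]
      exact mem_oscMomStep hω hc hs k ih1 ih2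

/-- The moments `μⱼ = A · cosMom j + B · sinMom j` of the re-centred weight in interval arithmetic (scale `T`).
[cite: DavisRabinowitz1984, Sect. 2.10.2] -/
def oscMuI (T : ℕ) (A B : MI) (ω h : ℚ) (cI sI : MI) (j : ℕ) : MI :=
  let p := oscMomI ω h cI sI j
  (MI.mul T A p.1).add (MI.mul T B p.2)

/-- [cite: DavisRabinowitz1984, Sect. 2.10.2] -/
theorem mem_oscMuI {T : ℕ} (hT : 0 < T) {Ar Br : ℝ} {A B : MI} (hA : MI.mem T Ar A) (hB : MI.mem T Br B)
    {ω h : ℚ} (hω : ω ≠ 0) {cI sI : MI} (hc : MI.mem T (Real.cos ((ω : ℝ) * h)) cI)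
    (hs : MI.mem T (Real.sin ((ω : ℝ) * h)) sI) (j : ℕ) :
    MI.mem T (Ar * cosMom ω h j + Br * sinMom ω h j) (oscMuI T A B ω h cI sI j) := by
  obtain ⟨h1, h2⟩ := mem_oscMomI hω hc hs j
  exact MI.mem_add (MI.mem_mul hT hA h1) (MI.mem_mul hT hB h2)

/-- The coefficient enclosures of the re-centred weight: `A ∋ a cos θ + b sin θ`, `B ∋ b cos θ − a sin θ` from
`cθ ∋ cos θ`, `sθ ∋ sin θ`. [cite: DavisRabinowitz1984, Sect. 2.10.2] -/
def oscCoefI (cθ sθ : MI) (w : OscW) : MI × MI :=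
  ((mulRatI cθ w.a).add (mulRatI sθ w.b), (mulRatI cθ w.b).sub (mulRatI sθ w.a))

/-- [cite: DavisRabinowitz1984, Sect. 2.10.2] -/
theorem mem_oscCoefI {T : ℕ} {θ : ℝ} {cθ sθ : MI} (hc : MI.mem T (Real.cos θ) cθ) (hs : MI.mem T (Real.sin θ) sθ)
    (w : OscW) :
    MI.mem T ((w.a : ℝ) * Real.cos θ + (w.b : ℝ) * Real.sin θ) (oscCoefI cθ sθ w).1 ∧
      MI.mem T ((w.b : ℝ) * Real.cos θ - (w.a : ℝ) * Real.sin θ) (oscCoefI cθ sθ w).2 := by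
  refine ⟨?_, ?_⟩
  · have m := MI.mem_add (mem_mulRatI hc w.a) (mem_mulRatI hs w.b)
    have e : Real.cos θ * (w.a : ℝ) + Real.sin θ * (w.b : ℝ) = (w.a : ℝ) * Real.cos θ + (w.b : ℝ) * Real.sin θ := by
      ring
    rw [oscCoefI, ← e]; exact m
  · have m := MI.mem_sub (mem_mulRatI hc w.b) (mem_mulRatI hs w.a)
    have e : Real.cos θ * (w.b : ℝ) - Real.sin θ * (w.a : ℝ) = (w.b : ℝ) * Real.cos θ - (w.a : ℝ) * Real.sin θ := by
      ring
    rw [oscCoefI, ← e]; exact m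

/-- The exact part of the oscillatory panel rule at scale `prm.T`: the midpoint polynomial of `W` paired with the
interval moments of the re-centred weight (`wsumI`). [cite: DavisRabinowitz1984, Sect. 2.10.2] [cite: Iserles2004, Sect. 3] -/
def oscMainI (prm : OscPrm) (S : ℕ) (h : ℚ) (W : IPoly) (w : OscW) (c : ℚ) : MI :=
  wsumI (oscMuI prm.T (oscCoefI (trigPt prm (w.ω * c + w.φ)).1.re (trigPt prm (w.ω * c + w.φ)).1.im w).1
      (oscCoefI (trigPt prm (w.ω * c + w.φ)).1.re (trigPt prm (w.ω * c + w.φ)).1.im w).2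
      w.ω h (trigPt prm (w.ω * h)).1.re (trigPt prm (w.ω * h)).1.im) (midPoly S W) 0

/-- **The oscillatory panel enclosure** of `∫_{-h}^{h} f(c + u) w(c + u) du` from a Taylor model `W` of
`u ↦ f(c + u)`: the midpoint polynomial of `W` paired with the interval moments of the re-centred weight (`oscMainI`,
scale `prm.T`, rescaled to `S`), widened by the remainder bound `⌈tabsI S h (W − p_W) · 2h (|a| + |b|)⌉`; with the
acceptance flag of the two point enclosures (`cos`, `sin` at `ω h` and at `θ = ω c + φ`).  This is the Filon-type
rule `Q^F[f] = I[f̃]` with `f̃ = p_W`, plus a certified remainder. [cite: DavisRabinowitz1984, Sect. 2.10.2] [cite: Iserles2004, Sect. 3] -/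
def oscPanelI (prm : OscPrm) (S : ℕ) (h : ℚ) (W : IPoly) (w : OscW) (c : ℚ) : MI × Bool :=
  (MI.widen (MI.rescale prm.T S (oscMainI prm S h W w c))
      ⌈(tabsI S h (tsubI W (ratPolyI S (midPoly S W))) : ℚ) * (2 * h * (|w.a| + |w.b|))⌉,
    (trigPt prm (w.ω * h)).2 && (trigPt prm (w.ω * c + w.φ)).2)

/-- **Soundness of the oscillatory panel enclosure.** [cite: DavisRabinowitz1984, Sect. 2.10.2] [cite: Iserles2004, Sect. 3] -/
theorem mem_oscPanelI {prm : OscPrm} (hT : 0 < prm.T) {S : ℕ} (hS : 0 < S) {h : ℚ} (h0 : 0 ≤ h) {f : ℝ → ℝ}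
    {W : IPoly} (hf : TMem S h f W) (hfi : IntervalIntegrable f volume (-(h : ℝ)) h) {w : OscW} (hω : w.ω ≠ 0)
    (c : ℚ) (hok : (oscPanelI prm S h W w c).2 = true) :
    MI.mem S (∫ u in (-(h : ℝ))..h, f u * w.toFun ((c : ℝ) + u)) (oscPanelI prm S h W w c).1 := by
  have hok' : (trigPt prm (w.ω * h)).2 = true ∧ (trigPt prm (w.ω * c + w.φ)).2 = true := by
    simpa [oscPanelI, Bool.and_eq_true] using hok
  obtain ⟨hokh, hokθ⟩ := hok'
  obtain ⟨hch, hsh⟩ := mem_trigPt hT hokh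
  obtain ⟨hcθ, hsθ⟩ := mem_trigPt hT hokθ
  simp only [Rat.cast_mul, Rat.cast_add] at hch hsh hcθ hsθ
  obtain ⟨hA, hB⟩ := mem_oscCoefI hcθ hsθ w
  -- the moments of the re-centred weight
  set Ar : ℝ := (w.a : ℝ) * Real.cos ((w.ω : ℝ) * c + w.φ) + (w.b : ℝ) * Real.sin ((w.ω : ℝ) * c + w.φ) with hAr
  set Br : ℝ := (w.b : ℝ) * Real.cos ((w.ω : ℝ) * c + w.φ) - (w.a : ℝ) * Real.sin ((w.ω : ℝ) * c + w.φ) with hBr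
  set μ : ℕ → ℝ := fun j => Ar * cosMom w.ω h j + Br * sinMom w.ω h j with hμ
  have hN : ∀ j : ℕ, MI.mem prm.T (μ j)
      (oscMuI prm.T (oscCoefI (trigPt prm (w.ω * c + w.φ)).1.re (trigPt prm (w.ω * c + w.φ)).1.im w).1
        (oscCoefI (trigPt prm (w.ω * c + w.φ)).1.re (trigPt prm (w.ω * c + w.φ)).1.im w).2
        w.ω h (trigPt prm (w.ω * h)).1.re (trigPt prm (w.ω * h)).1.im j) :=
    fun j => mem_oscMuI hT hA hB hω hch hsh j
  -- the re-centred weight, its integrability and moments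
  have hWc_cont : Continuous fun u : ℝ => w.toFun ((c : ℝ) + u) :=
    w.continuous_toFun.comp (continuous_const.add continuous_id)
  have hWci : IntervalIntegrable (fun u : ℝ => w.toFun ((c : ℝ) + u)) volume (-(h : ℝ)) h :=
    hWc_cont.intervalIntegrable _ _
  have hmom : ∀ i : ℕ, ∫ u in (-(h : ℝ))..h, w.toFun ((c : ℝ) + u) * u ^ i = μ i := fun i => by
    rw [hμ]
    exact w.integral_toFun_centre_mul_pow c h i
  -- the exact part: the midpoint polynomial against the weight
  have hx : ∫ u in (-(h : ℝ))..h, Poly.eval (midPoly S W) u * w.toFun ((c : ℝ) + u) =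
      wsumR μ ((midPoly S W).map ((↑) : ℚ → ℝ)) 0 := by
    rw [← integral_weight_mul_pow_mul_evalR hWci hmom ((midPoly S W).map ((↑) : ℚ → ℝ)) 0]
    exact integral_congr fun u _ => by simp only [Poly.eval_eq_evalR, pow_zero, mul_one]; ring
  have hxT : MI.mem prm.T (wsumR μ ((midPoly S W).map ((↑) : ℚ → ℝ)) 0) (oscMainI prm S h W w c) :=
    mem_wsumI hN (midPoly S W) 0
  have hxS := MI.mem_rescale hT S hxT
  rw [← hx] at hxS
  -- the remainder
  have hb := abs_integral_mul_weight_sub_le hS h0 hf hfi hWc_cont (fun u => w.abs_toFun_le ((c : ℝ) + u))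
    (midPoly S W)
  refine MI.mem_widen hxS ?_
  have hSr : (0 : ℝ) < S := by exact_mod_cast hS
  have hb' : |(∫ u in (-(h : ℝ))..h, f u * w.toFun ((c : ℝ) + u)) -
      ∫ u in (-(h : ℝ))..h, Poly.eval (midPoly S W) u * w.toFun ((c : ℝ) + u)| ≤
      (tabsI S h (tsubI W (ratPolyI S (midPoly S W))) : ℝ) * (2 * h * (((|w.a| + |w.b| : ℚ)) : ℝ)) / S := by
    rwa [div_mul_eq_mul_div] at hb
  have h1 := (le_div_iff₀ hSr).1 hb'
  refine h1.trans ?_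
  have h2 := Int.le_ceil ((tabsI S h (tsubI W (ratPolyI S (midPoly S W))) : ℚ) * (2 * h * (|w.a| + |w.b|)))
  exact_mod_cast h2

/-! ### Part C. Segments -/

/-- **Segment predicate** for the oscillatory lane: the scaled integral `S · ∫_a^b f(t) w(t) dt` lies in `[lo, hi]`
and the integrand is interval integrable on `[a, b]`. [cite: MahboubiMelquiondSibutpinote2016, Sect. 3.3] -/
def OSegOK (f w : ℝ → ℝ) (S : ℕ) (a b : ℚ) (lo hi : ℤ) : Prop :=
  (lo : ℝ) ≤ S * ∫ t in (a : ℝ)..(b : ℝ), f t * w t ∧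
    S * ∫ t in (a : ℝ)..(b : ℝ), f t * w t ≤ (hi : ℝ) ∧
      IntervalIntegrable (fun t => f t * w t) volume (a : ℝ) (b : ℝ)

/-- The empty segment. [cite: MahboubiMelquiondSibutpinote2016, Sect. 3.3] -/
theorem OSegOK.nil (f w : ℝ → ℝ) (S : ℕ) (a : ℚ) : OSegOK f w S a a 0 0 := by
  refine ⟨?_, ?_, IntervalIntegrable.refl⟩ <;> simp

/-- **Gluing two adjacent segments.** [cite: MahboubiMelquiondSibutpinote2016, Sect. 3.3] -/
theorem OSegOK.append {f w : ℝ → ℝ} {S : ℕ} {a b c : ℚ} {lo₁ hi₁ lo₂ hi₂ : ℤ}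
    (h₁ : OSegOK f w S a b lo₁ hi₁) (h₂ : OSegOK f w S b c lo₂ hi₂) :
    OSegOK f w S a c (lo₁ + lo₂) (hi₁ + hi₂) := by
  obtain ⟨l1, u1, i1⟩ := h₁
  obtain ⟨l2, u2, i2⟩ := h₂
  refine ⟨?_, ?_, i1.trans i2⟩
  · rw [← intervalIntegral.integral_add_adjacent_intervals i1 i2, mul_add]; push_cast; linarith
  · rw [← intervalIntegral.integral_add_adjacent_intervals i1 i2, mul_add]; push_cast; linarith

/-- From a segment to bounds on the integral itself (`lo' · S ≤ lo`, `hi ≤ hi' · S`).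
[cite: MahboubiMelquiondSibutpinote2016, Sect. 3.2 Lemma 3, Sect. 3.3] -/
theorem OSegOK.bounds {f w : ℝ → ℝ} {S : ℕ} {a b : ℚ} {lo hi : ℤ} (hs : OSegOK f w S a b lo hi)
    (hS : 0 < S) {lo' hi' : ℚ} (hlo : lo' * S ≤ lo) (hhi : (hi : ℚ) ≤ hi' * S) :
    (lo' : ℝ) ≤ ∫ t in (a : ℝ)..(b : ℝ), f t * w t ∧ ∫ t in (a : ℝ)..(b : ℝ), f t * w t ≤ (hi' : ℝ) := by
  obtain ⟨l, u, -⟩ := hs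
  have hSr : (0 : ℝ) < S := by exact_mod_cast hS
  have hloR : (lo' : ℝ) * S ≤ (lo : ℝ) := by exact_mod_cast hlo
  have hhiR : (hi : ℝ) ≤ (hi' : ℝ) * S := by exact_mod_cast hhi
  rw [mul_comm (S : ℝ)] at l u
  exact ⟨le_of_mul_le_mul_right (hloR.trans l) hSr, le_of_mul_le_mul_right (u.trans hhiR) hSr⟩

/-- **A panel segment from a Taylor model** (oscillatory weight): if `W` encloses `u ↦ f(c + u)` on `|u| ≤ h` for a
measurable `f`, the panel enclosure `oscPanelI` is accepted and lies inside `[plo, phi]`, then the segment over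
`[c − h, c + h]` is certified. [cite: MahboubiMelquiondSibutpinote2016, Sect. 3.2 Lemma 3] [cite: DavisRabinowitz1984, Sect. 2.10.2] -/
theorem osegOK_of_tmem {prm : OscPrm} (hT : 0 < prm.T) {S : ℕ} (hS : 0 < S) {h : ℚ} (h0 : 0 < h) {f : ℝ → ℝ}
    (hf : Measurable f) {w : OscW} (hω : w.ω ≠ 0) (c : ℚ) {W : IPoly}
    (hW : TMem S h (fun u => f ((c : ℝ) + u)) W) (hok : (oscPanelI prm S h W w c).2 = true) {plo phi : ℤ}
    (hlo : plo ≤ (oscPanelI prm S h W w c).1.lo) (hhi : (oscPanelI prm S h W w c).1.hi ≤ phi) :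
    OSegOK f w.toFun S (c - h) (c + h) plo phi := by
  have hfi : IntervalIntegrable (fun u => f ((c : ℝ) + u)) volume (-(h : ℝ)) h :=
    intervalIntegrable_of_tmem hS h0.le hW (hf.comp (measurable_const.add measurable_id))
  have hm := mem_oscPanelI hT hS h0.le hW hfi hω c hok
  have e1 : -(h : ℝ) + (c : ℝ) = ((c - h : ℚ) : ℝ) := by push_cast; ring
  have e2 : (h : ℝ) + (c : ℝ) = ((c + h : ℚ) : ℝ) := by push_cast; ring
  have hI : IntervalIntegrable (fun t => f t * w.toFun t) volume ((c - h : ℚ) : ℝ) ((c + h : ℚ) : ℝ) := by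
    have h1 := hfi.comp_sub_right (c : ℝ)
    have e0 : (fun x => f ((c : ℝ) + (x - (c : ℝ)))) = f := by
      funext x; congr 1; ring
    rw [e0, e1, e2] at h1
    exact h1.mul_continuousOn w.continuous_toFun.continuousOn
  have e : ∫ u in (-(h : ℝ))..h, f ((c : ℝ) + u) * w.toFun ((c : ℝ) + u) =
      ∫ t in ((c - h : ℚ) : ℝ)..((c + h : ℚ) : ℝ), f t * w.toFun t := by
    have hs := intervalIntegral.integral_comp_add_left (fun t => f t * w.toFun t) (c : ℝ) (a := -(h : ℝ)) (b := h)
    rw [hs, ← e1, ← e2]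
    congr 1 <;> ring
  rw [e] at hm
  obtain ⟨hm1, hm2⟩ := hm
  have hloR : ((plo : ℤ) : ℝ) ≤ ((oscPanelI prm S h W w c).1.lo : ℝ) := by exact_mod_cast hlo
  have hhiR : ((oscPanelI prm S h W w c).1.hi : ℝ) ≤ ((phi : ℤ) : ℝ) := by exact_mod_cast hhi
  refine ⟨?_, ?_, hI⟩
  · rw [mul_comm]; exact hloR.trans hm1
  · rw [mul_comm]; exact hm2.trans hhiR

/-! ### Part D. Certificates, generic in the statement family -/

namespace OpSem

variable {M : OpModel} (F : OpSem M)

/-- [folklore] -/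
private theorem measurable_getReg_consO {f : ℝ → ℝ} {fs : List (ℝ → ℝ)} (hf : Measurable f)
    (hfs : ∀ i, Measurable (getReg (fun _ => (0 : ℝ)) fs i)) :
    ∀ i, Measurable (getReg (fun _ => (0 : ℝ)) (f :: fs) i)
  | 0 => by simpa using hf
  | i + 1 => by simpa using hfs i

/-- [folklore] -/
private theorem measurable_runFO : ∀ (p : GProg M) (fs : List (ℝ → ℝ)),
    (∀ i, Measurable (getReg (fun _ => (0 : ℝ)) fs i)) →
      ∀ i, Measurable (getReg (fun _ => (0 : ℝ)) (F.runF p fs) i)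
  | [], fs, hfs => by simpa [runF] using hfs
  | op :: p, fs, hfs => by
      rw [runF]
      exact measurable_runFO p _ (measurable_getReg_consO (F.measurable_evalF hfs op) hfs)

/-- [folklore] -/
private theorem measurable_constStackO : ∀ (ps : List ℝ) (i : ℕ),
    Measurable (getReg (fun _ => (0 : ℝ)) (constStack ps) i)
  | [], i => by rw [constStack, List.map_nil, getReg_nil]; exact measurable_const
  | c :: ps, 0 => by
      simp only [constStack, List.map_cons, getReg_cons_zero]
      exact measurable_const
  | c :: ps, i + 1 => by simpa [constStack] using measurable_constStackO ps i

/-- The function denoted by a program with parameters is measurable. [folklore] -/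
private theorem measurable_toFunPO (p : GProg M) (ps : List ℝ) : Measurable (F.toFunP p ps) := by
  unfold toFunP
  exact F.measurable_runFO p (constStack ps) (measurable_constStackO ps) 0

end OpSem

namespace OpModel

variable (M : OpModel)

/-- **The per-panel certificate** (oscillatory weight): positivity of `S`, `T`, `h`, `ω ≠ 0`, the panel model of the
program on `[c − h, c + h]` accepted, the panel enclosure accepted and inside `[plo, phi]`.
[cite: MahboubiMelquiondSibutpinote2016, Sect. 3.2 Lemma 3] [cite: DavisRabinowitz1984, Sect. 2.10.2] -/
def oscPanelCheck (prm : M.Prm) (oprm : OscPrm) (S : ℕ) (c h : ℚ) (p : GProg M) (B : PBox) (w : OscW)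
    (cs : List (List ℤ × ℕ)) (plo phi : ℤ) : Bool :=
  let r := M.pmodelP prm S h c p B cs
  let I := oscPanelI oprm S h r.1 w c
  decide (0 < S) && decide (0 < oprm.T) && decide (0 < h) && decide (w.ω ≠ 0) && r.2 && I.2 &&
    decide (plo ≤ I.1.lo) && decide (I.1.hi ≤ phi)

/-- A leaf of an oscillatory certificate: the panel `[c − h, c + h]`, its certificate candidates, and the claimed
scaled enclosure `[plo, phi]` of `S ∫_{c−h}^{c+h} P w`. [cite: MahboubiMelquiondSibutpinote2016, Sect. 3.3] -/
structure OscLeaf : Type where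
  /-- panel centre -/
  c : ℚ
  /-- panel half-width -/
  h : ℚ
  /-- certificate candidates of the panel (one per `inv` / `sqrt` statement) -/
  cs : List (List ℤ × ℕ)
  /-- claimed scaled lower bound -/
  plo : ℤ
  /-- claimed scaled upper bound -/
  phi : ℤ
  deriving Repr, Inhabited

/-- The leaves tile `[a, b]` in order: each leaf starts where the previous one ends.
[cite: MahboubiMelquiondSibutpinote2016, Sect. 3.3] -/
def oscChain : ℚ → List OscLeaf → ℚ → Bool
  | a, [], b => decide (a = b)
  | a, l :: L, b => decide (l.c - l.h = a) && oscChain (l.c + l.h) L b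

/-- Sum of the claimed lower bounds. [cite: MahboubiMelquiondSibutpinote2016, Sect. 3.3] -/
def oscSumLo : List OscLeaf → ℤ
  | [] => 0
  | l :: L => l.plo + oscSumLo L

/-- Sum of the claimed upper bounds. [cite: MahboubiMelquiondSibutpinote2016, Sect. 3.3] -/
def oscSumHi : List OscLeaf → ℤ
  | [] => 0
  | l :: L => l.phi + oscSumHi L

/-- Every leaf passes its panel certificate. [cite: MahboubiMelquiondSibutpinote2016, Sect. 3.3] -/
def oscLeavesCheck (prm : M.Prm) (oprm : OscPrm) (S : ℕ) (p : GProg M) (B : PBox) (w : OscW) :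
    List OscLeaf → Bool
  | [] => true
  | l :: L => M.oscPanelCheck prm oprm S l.c l.h p B w l.cs l.plo l.phi && oscLeavesCheck prm oprm S p B w L

/-- **The leaf-list certificate** for `lo ≤ ∫_a^b P(ps; t) w(t) dt ≤ hi`, uniformly over the parameter box:
positivity of `S`, the leaves tile `[a, b]`, every leaf certified, and the summed enclosure inside `[lo·S, hi·S]`.
[cite: MahboubiMelquiondSibutpinote2016, Sect. 3.3] [cite: DavisRabinowitz1984, Sect. 2.10.2] -/
def oscCertCheck (prm : M.Prm) (oprm : OscPrm) (S : ℕ) (p : GProg M) (B : PBox) (w : OscW) (a b : ℚ)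
    (L : List OscLeaf) (lo hi : ℚ) : Bool :=
  decide (0 < S) && oscChain a L b && M.oscLeavesCheck prm oprm S p B w L &&
    decide (lo * S ≤ (oscSumLo L : ℚ)) && decide ((oscSumHi L : ℚ) ≤ hi * S)

/-! ### Part E. Certificate generation (untrusted, outside the kernel; `#eval`) -/

/-- The leaf `[c − h, c + h]` with the kernel's own panel enclosure as the claimed one, and its acceptance flag
(PROPOSAL only — certified by `oscPanelCheck`). [cite: MahboubiMelquiondSibutpinote2016, Sect. 3.3] -/
def oscLeafOf (prm : M.Prm) (oprm : OscPrm) (S : ℕ) (p : GProg M) (B : PBox) (w : OscW) (c h : ℚ)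
    (cs : List (List ℤ × ℕ)) : OscLeaf × Bool :=
  let r := M.pmodelP prm S h c p B cs
  let I := oscPanelI oprm S h r.1 w c
  (⟨c, h, cs, I.1.lo, I.1.hi⟩, r.2 && I.2)

/-- A run of `n` equal leaves of half-width `h` starting at `a` (no certificate candidates), with the conjunctive
acceptance flag (PROPOSAL only). [cite: MahboubiMelquiondSibutpinote2016, Sect. 3.3] -/
def oscUniform (prm : M.Prm) (oprm : OscPrm) (S : ℕ) (p : GProg M) (B : PBox) (w : OscW) (h : ℚ) :
    ℕ → ℚ → List OscLeaf × Bool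
  | 0, _ => ([], true)
  | n + 1, a =>
      let r := M.oscLeafOf prm oprm S p B w (a + h) h []
      let t := oscUniform prm oprm S p B w h n (a + 2 * h)
      (r.1 :: t.1, r.2 && t.2)

/-- Dyadic bisection of the panel `[c − h, c + h]` (no certificate candidates): a leaf is kept when it is accepted
and its scaled enclosure is narrower than `tol · 2h`, else it is halved; `fuel` bounds the depth (PROPOSAL only —
every leaf is re-checked by the kernel in `oscCertCheck`). [cite: MahboubiMelquiondSibutpinote2016, Sect. 3.3] -/
def oscAdapt (prm : M.Prm) (oprm : OscPrm) (S : ℕ) (p : GProg M) (B : PBox) (w : OscW) (tol : ℚ) :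
    ℕ → ℚ → ℚ → List OscLeaf × Bool
  | 0, c, h =>
      let r := M.oscLeafOf prm oprm S p B w c h []
      ([r.1], r.2)
  | fuel + 1, c, h =>
      let r := M.oscLeafOf prm oprm S p B w c h []
      if r.2 && decide (((r.1.phi - r.1.plo : ℤ) : ℚ) ≤ tol * (2 * h)) then ([r.1], true)
      else
        let s := oscAdapt prm oprm S p B w tol fuel (c - h / 2) (h / 2)
        let t := oscAdapt prm oprm S p B w tol fuel (c + h / 2) (h / 2)
        (s.1 ++ t.1, s.2 && t.2)

/-- The summed claimed enclosure of a leaf list, as rationals at scale `1` (for choosing `lo`, `hi`).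
[cite: MahboubiMelquiondSibutpinote2016, Sect. 3.3] -/
def oscSums (S : ℕ) (L : List OscLeaf) : ℚ × ℚ := ((oscSumLo L : ℚ) / S, (oscSumHi L : ℚ) / S)

end OpModel

namespace OpSem

variable {M : OpModel} (F : OpSem M)

/-- **Soundness of the per-panel certificate**, for every parameter vector of the box: a certified segment
`OSegOK (F.toFunP p ps) w.toFun S (c − h) (c + h) plo phi`.
[cite: MahboubiMelquiondSibutpinote2016, Sect. 3.2 Lemma 3, Sect. 4.1] [cite: DavisRabinowitz1984, Sect. 2.10.2] -/
theorem osegOK_of_oscPanelCheck {prm : M.Prm} {oprm : OscPrm} {S : ℕ} {c h : ℚ} {p : GProg M} {B : PBox}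
    {w : OscW} {cs : List (List ℤ × ℕ)} {plo phi : ℤ}
    (hc : M.oscPanelCheck prm oprm S c h p B w cs plo phi = true) {ps : List ℝ} (hB : BoxMem ps B) :
    OSegOK (F.toFunP p ps) w.toFun S (c - h) (c + h) plo phi := by
  unfold OpModel.oscPanelCheck at hc
  simp only [Bool.and_eq_true, decide_eq_true_eq] at hc
  obtain ⟨⟨⟨⟨⟨⟨⟨hS, hT⟩, h0⟩, hω⟩, hok⟩, hokI⟩, hlo⟩, hhi⟩ := hc
  exact osegOK_of_tmem hT hS h0 (F.measurable_toFunPO p ps) hω c (F.tmem_pmodelP prm hS h0.le c p hB cs hok)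
    hokI hlo hhi

/-- **Soundness of the leaf checks along a chain**: the glued segment over `[a, b]` with the summed bounds.
[cite: MahboubiMelquiondSibutpinote2016, Sect. 3.3] -/
theorem osegOK_of_oscLeavesCheck {prm : M.Prm} {oprm : OscPrm} {S : ℕ} {p : GProg M} {B : PBox} {w : OscW}
    {ps : List ℝ} (hB : BoxMem ps B) :
    ∀ (L : List OpModel.OscLeaf) (a b : ℚ), OpModel.oscChain a L b = true →
      M.oscLeavesCheck prm oprm S p B w L = true →
        OSegOK (F.toFunP p ps) w.toFun S a b (OpModel.oscSumLo L) (OpModel.oscSumHi L)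
  | [], a, b, hch, _ => by
      simp only [OpModel.oscChain, decide_eq_true_eq] at hch
      subst hch
      simpa [OpModel.oscSumLo, OpModel.oscSumHi] using OSegOK.nil (F.toFunP p ps) w.toFun S a
  | l :: L, a, b, hch, hck => by
      simp only [OpModel.oscChain, Bool.and_eq_true, decide_eq_true_eq] at hch
      simp only [OpModel.oscLeavesCheck, Bool.and_eq_true] at hck
      obtain ⟨hl, hrest⟩ := hch
      have h1 := F.osegOK_of_oscPanelCheck hck.1 hB
      rw [hl] at h1
      have h2 := osegOK_of_oscLeavesCheck hB L (l.c + l.h) b hrest hck.2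
      simpa [OpModel.oscSumLo, OpModel.oscSumHi] using h1.append h2

/-- **Soundness of the leaf-list certificate**: the kernel's re-computation of every panel enclosure from the
untrusted leaves bounds the oscillatory integral for EVERY parameter vector of the box.
[cite: MahboubiMelquiondSibutpinote2016, Sect. 3.3, Sect. 4.1] [cite: DavisRabinowitz1984, Sect. 2.10.2] [cite: Iserles2004, Sect. 3] -/
theorem integral_bounds_of_oscCertCheck {prm : M.Prm} {oprm : OscPrm} {S : ℕ} {p : GProg M} {B : PBox}
    {w : OscW} {a b : ℚ} {L : List OpModel.OscLeaf} {lo hi : ℚ}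
    (hc : M.oscCertCheck prm oprm S p B w a b L lo hi = true) {ps : List ℝ} (hB : BoxMem ps B) :
    (lo : ℝ) ≤ ∫ t in (a : ℝ)..(b : ℝ), F.toFunP p ps t * w.toFun t ∧
      ∫ t in (a : ℝ)..(b : ℝ), F.toFunP p ps t * w.toFun t ≤ (hi : ℝ) := by
  unfold OpModel.oscCertCheck at hc
  simp only [Bool.and_eq_true, decide_eq_true_eq] at hc
  obtain ⟨⟨⟨⟨hS, hch⟩, hck⟩, hlo⟩, hhi⟩ := hc
  exact (F.osegOK_of_oscLeavesCheck hB L a b hch hck).bounds hS hlo hhi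

/-- The integrand of a certified leaf list is interval integrable on `[a, b]`.
[cite: MahboubiMelquiondSibutpinote2016, Sect. 3.3] -/
theorem intervalIntegrable_of_oscCertCheck {prm : M.Prm} {oprm : OscPrm} {S : ℕ} {p : GProg M} {B : PBox}
    {w : OscW} {a b : ℚ} {L : List OpModel.OscLeaf} {lo hi : ℚ}
    (hc : M.oscCertCheck prm oprm S p B w a b L lo hi = true) {ps : List ℝ} (hB : BoxMem ps B) :
    IntervalIntegrable (fun t => F.toFunP p ps t * w.toFun t) volume (a : ℝ) (b : ℝ) := by
  unfold OpModel.oscCertCheck at hc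
  simp only [Bool.and_eq_true, decide_eq_true_eq] at hc
  obtain ⟨⟨⟨⟨_, hch⟩, hck⟩, _⟩, _⟩ := hc
  exact (F.osegOK_of_oscLeavesCheck hB L a b hch hck).2.2

end OpSem

end PolyMP

end Literature.Analysis.ValidatedNumerics
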